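import Mathlib
import Summits.ValiantsHypothesis.ValiantsHypothesis.Theorems.LacunarySymmetroidDoorA26GraftInflectionBudget
import Summits.ValiantsHypothesis.ValiantsHypothesis.Theorems.LacunarySymmetroidDoorA26GraftSecancyInflection

/-!
# Route `LacunarySymmetroid` — crux `DoorA26` (stmt-ValiantsHypothesis-19979): the secancy–inflection lemma IN PENCIL CURRENCY
# (three collinear points on a graph-like arc of the lacunary letter curve ⟹ a root of the inflection fewnomial between them)

HONEST FRAMING.  Cell `pub-symmetroid`, seat `val-sym-door-p4` (gen 12); helper file `--supports stmt-ValiantsHypothesis-19979` (`DoorA26`,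
OPEN, never asserted).  Glue between p689485 `…GraftInflectionBudget` (the inflection fewnomial `Infl = det[ Σ_l C(d_l^r v_{l,a}) X^{d_l} ]`
and its budget `< C(K,3)`) and p690286 `…GraftSecancyInflection` (Rolle twice: three collinear points on a graph-like arc of a curve force
`det(W,W′,W″) = 0`).  Here the curve is the LACUNARY LETTER CURVE itself, `W(x)_a = (Σ_l C(v_{l,a}) X^{d_l}).eval x`, with its honest
derivatives (`Polynomial.derivative`, `Polynomial.hasDerivAt`):

* `eulerRow_one_eq`, `eulerRow_two_eq` — the Euler rows of p689485 ARE `X·P′` and `X·(X·P′)′` (from `euler_sum`);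
  `eval_eulerRow_one`, `eval_eulerRow_two` — at a point: `z·P′(z)` and `z²·P″(z) + z·P′(z)`;
* `eval_infl_eq` — `Infl(z) = z³ · det(W(z), W′(z), W″(z))`;
* **`exists_posRoot_infl_of_three_collinear`** — if a line `{η = 0}` meets the letter curve at `0 < x₁ < x₂ < x₃` on an arc that is graph-like
  in an affine chart (`α·W ≠ 0` and the Wronskian of `(α·W, β·W)` non-zero on `[x₁,x₃]`, `det[α;β;η] ≠ 0`), then the inflection fewnomial has
  a root in `(x₁, x₃)`.  READING (graft dictionary, memo DOOR-A26-P4G12-REPORT): a graft letter `S` whose polar `2·polar(P(x), S) = η·W(x)`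
  vanishes three times beyond the root span on a graph-like end arc forces an END-ARC INFLECTION (`ι_end ≥ 1`); with p690781, four times force two.

[folklore] Rolle; product rule.  No `def`, no `sorry`.  Nothing here bears on `DoorA26` / `DoorA34` (OPEN), the registers, `MatrixDescartes`
(stmt-ValiantsHypothesis-18050) or `VP ≠ VNP`.
-/

-- `Summit.ValiantsHypothesis.ValiantsHypothesis.…` repeats a component by the D-0017 layout
-- (single-conjunct summit), which the `dupNamespace` linter flags; the name is mandated.
set_option linter.dupNamespace false

namespace Summit.ValiantsHypothesis.ValiantsHypothesis.Theorems.LacunarySymmetroid.DoorA26.Inflection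

open Polynomial Matrix Finset Set
open scoped BigOperators

variable {K : ℕ}

/-! ### 1. Euler rows are honest derivatives -/

/-- Row `1` of the inflection matrix is `X · P′` (letter polynomial `P_a = Σ_l C(v_{l,a}) X^{d_l}`). [folklore] -/
theorem eulerRow_one_eq (d : Fin K → ℕ) (v : Fin K → Fin 3 → ℝ) (a : Fin 3) :
    (∑ l, C (((d l : ℝ) ^ (1 : ℕ)) * v l a) * X ^ (d l)) = X * derivative (∑ l, C (v l a) * X ^ (d l)) := by
  rw [euler_sum]
  simp only [pow_one]

/-- Row `2` of the inflection matrix is `X · (X · P′)′`. [folklore] -/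
theorem eulerRow_two_eq (d : Fin K → ℕ) (v : Fin K → Fin 3 → ℝ) (a : Fin 3) :
    (∑ l, C (((d l : ℝ) ^ (2 : ℕ)) * v l a) * X ^ (d l)) =
      X * derivative (X * derivative (∑ l, C (v l a) * X ^ (d l))) := by
  rw [euler_sum, euler_sum]
  refine Finset.sum_congr rfl fun l _ => ?_
  ring_nf

/-- At a point: row `1` evaluates to `z · P′(z)`. [folklore] -/
theorem eval_eulerRow_one (d : Fin K → ℕ) (v : Fin K → Fin 3 → ℝ) (a : Fin 3) (z : ℝ) :
    (∑ l, ((d l : ℝ) ^ (1 : ℕ)) * v l a * z ^ (d l)) = z * (derivative (∑ l, C (v l a) * X ^ (d l))).eval z := by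
  have h := congrArg (fun p : ℝ[X] => p.eval z) (eulerRow_one_eq d v a)
  simp only [eval_finsetSum, eval_mul, eval_C, eval_pow, eval_X] at h
  exact h

/-- At a point: row `2` evaluates to `z² · P″(z) + z · P′(z)`. [folklore] -/
theorem eval_eulerRow_two (d : Fin K → ℕ) (v : Fin K → Fin 3 → ℝ) (a : Fin 3) (z : ℝ) :
    (∑ l, ((d l : ℝ) ^ (2 : ℕ)) * v l a * z ^ (d l)) =
      z ^ 2 * (derivative (derivative (∑ l, C (v l a) * X ^ (d l)))).eval z +
        z * (derivative (∑ l, C (v l a) * X ^ (d l))).eval z := by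
  have h := congrArg (fun p : ℝ[X] => p.eval z) (eulerRow_two_eq d v a)
  simp only [eval_finsetSum, eval_mul, eval_C, eval_pow, eval_X, derivative_mul, derivative_X, one_mul,
    eval_add] at h
  rw [h]
  ring

/-! ### 2. The inflection fewnomial at a point is `z³ · det(W, W′, W″)` -/

/-- **`Infl(z) = z³ · det(W(z), W′(z), W″(z))`** for the lacunary letter curve `W(x)_a = P_a(x)`, with honest first and second
derivatives of the letter polynomials. [folklore] -/
theorem eval_infl_eq (d : Fin K → ℕ) (v : Fin K → Fin 3 → ℝ) (z : ℝ) :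
    (Matrix.det (Matrix.of fun (r : Fin 3) (a : Fin 3) =>
        ∑ l, C (((d l : ℝ) ^ (r : ℕ)) * v l a) * X ^ (d l))).eval z =
      z ^ 3 * Matrix.det (Matrix.of
        ![fun a => (∑ l, C (v l a) * X ^ (d l)).eval z,
          fun a => (derivative (∑ l, C (v l a) * X ^ (d l))).eval z,
          fun a => (derivative (derivative (∑ l, C (v l a) * X ^ (d l)))).eval z]) := by
  rw [eval_det_inflMatrix, ← det_eulerRows_eq]
  congr 1
  ext r a
  fin_cases r
  · simp [eval_finsetSum]
  · simp only [Matrix.of_apply, Fin.mk_one, Fin.isValue, Matrix.cons_val_one, Matrix.cons_val_zero,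
      Pi.smul_apply, smul_eq_mul]
    have := eval_eulerRow_one d v a z
    simpa using this
  · simp only [Matrix.of_apply, Fin.reduceFinMk, Fin.isValue, Matrix.cons_val, Pi.add_apply, Pi.smul_apply,
      smul_eq_mul]
    have := eval_eulerRow_two d v a z
    simpa using this

/-! ### 3. Three collinear points on a graph-like arc of the letter curve force a root of `Infl` -/

/-- **SECANCY–INFLECTION IN PENCIL CURRENCY.**  Letters `v_l ∈ ℝ³`, exponents `d_l`, letter polynomials `P_a = Σ_l C(v_{l,a}) X^{d_l}` and
letter curve `W(x) = (P_a(x))_a`.  Let `α, β, η` be independent functionals (`det[α;β;η] ≠ 0`).  If on `[x₁, x₃]` (with `0 < x₁`) the chart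
functional `α·W` and the Wronskian `(α·W)(β·W)′ − (α·W)′(β·W)` do not vanish, and the line `{η = 0}` meets the curve at `x₁ < x₂ < x₃`,
then the inflection fewnomial `Infl` has a root `z ∈ (x₁, x₃)` (a POSITIVE root when `0 < x₁`, e.g. on an end arc beyond the root span). [folklore] -/
theorem exists_posRoot_infl_of_three_collinear (d : Fin K → ℕ) (v : Fin K → Fin 3 → ℝ) (α β η : Fin 3 → ℝ)
    {x₁ x₂ x₃ : ℝ} (h12 : x₁ < x₂) (h23 : x₂ < x₃)
    (hL : Matrix.det (Matrix.of ![α, β, η]) ≠ 0)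
    (hA0 : ∀ x ∈ Icc x₁ x₃, α ⬝ᵥ (fun a => (∑ l, C (v l a) * X ^ (d l)).eval x) ≠ 0)
    (hω : ∀ x ∈ Icc x₁ x₃,
      (α ⬝ᵥ fun a => (∑ l, C (v l a) * X ^ (d l)).eval x) *
          (β ⬝ᵥ fun a => (derivative (∑ l, C (v l a) * X ^ (d l))).eval x) -
        (α ⬝ᵥ fun a => (derivative (∑ l, C (v l a) * X ^ (d l))).eval x) *
          (β ⬝ᵥ fun a => (∑ l, C (v l a) * X ^ (d l)).eval x) ≠ 0)
    (h1 : η ⬝ᵥ (fun a => (∑ l, C (v l a) * X ^ (d l)).eval x₁) = 0)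
    (h2 : η ⬝ᵥ (fun a => (∑ l, C (v l a) * X ^ (d l)).eval x₂) = 0)
    (h3 : η ⬝ᵥ (fun a => (∑ l, C (v l a) * X ^ (d l)).eval x₃) = 0) :
    ∃ z ∈ Ioo x₁ x₃, (Matrix.det (Matrix.of fun (r : Fin 3) (a : Fin 3) =>
        ∑ l, C (((d l : ℝ) ^ (r : ℕ)) * v l a) * X ^ (d l))).eval z = 0 := by
  obtain ⟨z, hz, hdet⟩ := exists_inflection_of_three_collinear
    (W := fun x a => (∑ l, C (v l a) * X ^ (d l)).eval x)
    (W' := fun x a => (derivative (∑ l, C (v l a) * X ^ (d l))).eval x)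
    (W'' := fun x a => (derivative (derivative (∑ l, C (v l a) * X ^ (d l)))).eval x)
    α β η h12 h23 (fun a x => Polynomial.hasDerivAt _ x) (fun a x => Polynomial.hasDerivAt _ x) hL hA0 hω h1 h2 h3
  refine ⟨z, hz, ?_⟩
  rw [eval_infl_eq]
  have : Matrix.det (Matrix.of ![fun a => (∑ l, C (v l a) * X ^ (d l)).eval z,
      fun a => (derivative (∑ l, C (v l a) * X ^ (d l))).eval z,
      fun a => (derivative (derivative (∑ l, C (v l a) * X ^ (d l)))).eval z]) = 0 := hdet
  rw [this, mul_zero]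

end Summit.ValiantsHypothesis.ValiantsHypothesis.Theorems.LacunarySymmetroid.DoorA26.Inflection
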